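/-
Copyright (c) 2026 the pub-hodgecm-mathlib formalisation cell (harness21).  Prover seat hodgecm-mathlib-K2E3-p23 (g6), HCML Track B «K2-LIT» ∕ h413
(`stmt-HodgeConjecture-24833`), line `K2_E3_EllipticInputs`, road «GL₂-sc» (road owner K2E5-p17 (g5), dealer K2E3-plan (g4)), NON-ELLIPTIC half, brick 2N-0b,
FILE 2 OF 2: the `Fin 2` twin of ★ B4-1d file 2 `K2E3GL3ModUniformizerCentralizerCompact` (K2E3-p03 (g4)) — an irreducible characteristic polynomial makes
`Z_{G'}(ḡ)` compact (`G' = GL₂(F) ⧸ ϖ^ℤ·1`); the compactness criterion and its normal-form restatement.  2026-09-04.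
-/
import Summits.HodgeConjecture.HodgeConjecture.Theorems.K2E3GL2ModUniformizerCentralizerDichotomy   -- ★ FILE 1 (this seat): dichotomy, `mk_mem_centralizer_mk_iff`, `not_isCompact_centralizer_mk_of_not_irreducible`; brings the generic §1 of ★ `K2E3GL3ModUniformizerCentralizerCompact`
import HarnessLib

/-!
# Road «GL₂-sc», non-elliptic half, brick 2N-0b (file 2 of 2) — `χ_g` irreducible ⇒ `Z_{G'}(ḡ)` compact; the criterion; the case split of the non-elliptic bricks

Cell `pub/hodgecm-mathlib` (D-0151), Track B «K2-LIT», crux H413 = `stmt-HodgeConjecture-24833`, route of record `HCCMUnconditional`.  Lane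
`--supports stmt-HodgeConjecture-24833 --as helper`; THEOREMS ONLY (no `def`, no `instance`, no `notation`, no named-fact hypothesis, no `sorry`); count-neutral.
`Fin 2` reading of ★ B4-1d file 2 §3 (K2E3-p03 (g4), road «GL-[M6]-sc»); the generic §1–§2 of that file (`K[X]` is a field when `χ_X` is irreducible, the shell
rescaling) are IMPORTED, not restated.
* `isCompact_shell_two` — the shell `{c : F² | ∀ k, v(c_k) ≤ 1, ∃ k, v(c_k) = 1}` is compact;
* **`isCompact_centralizer_mk_of_irreducible`** — `χ_g` irreducible ⇒ `Z_{G'}(ḡ) = mk(F[g]^×) = mk(φ(S))` compact (the elliptic torus modulo the centre);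
* **`isCompact_centralizer_mk_iff_irreducible`** — for separable `χ_g`: `Z_{G'}(ḡ)` compact iff `χ_g` irreducible;
* **`not_isCompact_centralizer_mk_iff`** — THE CASE SPLIT at `N = 2`: `Z_{G'}(ḡ)` not compact iff `g = h · diag d · h⁻¹` with `d` injective (no mixed case).
[HarishChandra1970, Part VII §3; Cartier1979, §I.3–I.4; PlatonovRapinchuk1994, §3.3]
HONEST LABEL: HC_CM is proved only modulo the 7 printed citations (2 remaining named inputs: hLiu418 = stmt-HodgeConjecture-24832, h413 =
stmt-HodgeConjecture-24833) until rung 0 closes; count-neutral helper.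

## References
* [HarishChandra1970] Harish-Chandra (notes by G. van Dijk), *Harmonic Analysis on Reductive p-adic Groups*, LNM 162 (1970), Part VII §3.
* [Cartier1979] P. Cartier, *Representations of p-adic groups: a survey*, Corvallis (1979), §I.3–I.4.
* [PlatonovRapinchuk1994] V. Platonov, A. Rapinchuk, *Algebraic Groups and Number Theory* (1994), §3.3.
-/

set_option autoImplicit false
set_option linter.dupNamespace false   -- `Summit.HodgeConjecture.HodgeConjecture.…` (D-0017 nested layout; lakefile exemption for Summits)

noncomputable section

open Polynomial Topology
open scoped Matrix MatrixGroups WithZero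
open Literature.NumberTheory.Automorphic
open Summit.HodgeConjecture.HodgeConjecture.Cruxes.H413.K2E3GL3ModUniformizerCentralizerTrichotomy (irreducible_charpoly_two_iff_card_roots_eq_zero)
open Summit.HodgeConjecture.HodgeConjecture.Cruxes.H413.K2E3GL3ModUniformizerCentralizerCompact
  (exists_eq_sum_smul_pow_of_irreducible isUnit_sum_smul_pow_of_irreducible sum_mul_smul_pow sum_smul_pow_mul_comm exists_zpow_mul_mem_shell
    discr_ne_zero_of_separable)
open Summit.HodgeConjecture.HodgeConjecture.Cruxes.H413.K2E3GL2ModUniformizerCentralizerDichotomy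

namespace Summit.HodgeConjecture.HodgeConjecture.Cruxes.H413.K2E3GL2ModUniformizerCentralizerCompact

section Compact

variable {F : Type*} [Field F] [Valued F ℤᵐ⁰] [ValuativeRel F] [IsNonarchimedeanLocalField F] [(Valued.v : Valuation F ℤᵐ⁰).Compatible]

/-- The shell `S = {c : F² | ∀ k, v(c_k) ≤ 1, ∃ k, v(c_k) = 1}` is compact (`𝒪` is compact, the unit sphere is closed). [cite: Cartier1979, §I.3] -/
theorem isCompact_shell_two : IsCompact {c : Fin 2 → F | (∀ k, Valued.v (c k) ≤ 1) ∧ ∃ k, Valued.v (c k) = 1} := by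
  have hO : IsCompact {x : F | Valued.v x ≤ 1} := by
    have h : {x : F | Valued.v x ≤ 1} = {x : F | ValuativeRel.valuation F x ≤ 1} := Set.ext fun x => v_le_one_iff_valuation_le_one x
    rw [h]
    exact IsNonarchimedeanLocalField.isCompact_closedBall F 1
  have h1 : IsClosed {x : F | Valued.v x = 1} := by
    have h := Valuation.isClosed_sphere (v := (Valued.v : Valuation F ℤᵐ⁰)) 1
    simp only [Valuation.restrict_eq_one_iff] at h
    exact h
  have hpi : IsCompact {c : Fin 2 → F | ∀ k, Valued.v (c k) ≤ 1} := by
    have h : {c : Fin 2 → F | ∀ k, Valued.v (c k) ≤ 1} = Set.univ.pi fun _ => {x : F | Valued.v x ≤ 1} := by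
      ext c
      simp only [Set.mem_setOf_eq, Set.mem_univ_pi]
    rw [h]
    exact isCompact_univ_pi fun _ => hO
  have hcl : IsClosed {c : Fin 2 → F | ∃ k, Valued.v (c k) = 1} := by
    have h : {c : Fin 2 → F | ∃ k, Valued.v (c k) = 1} = ⋃ k, (fun c : Fin 2 → F => c k) ⁻¹' {x : F | Valued.v x = 1} := by
      ext c
      simp only [Set.mem_setOf_eq, Set.mem_iUnion, Set.mem_preimage]
    rw [h]
    exact isClosed_iUnion_of_finite fun k => h1.preimage (continuous_apply k)
  rw [Set.setOf_and]
  exact hpi.inter_right hcl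

/-- **`χ_g` irreducible ⇒ `Z_{G'}(ḡ)` is compact** (`G' = GL₂(F) ⧸ ϖ^ℤ·1`): `Z_{G'}(ḡ) = mk(F[g]^×) = mk(φ(S))` with `φ(c) = Σ c_k g^k` continuous on the
compact shell `S` into `GL₂(F)`.  This is the compactness modulo the centre of the elliptic torus `F[g]^×`.
[cite: HarishChandra1970, Part VII §3; cite: Cartier1979, §I.3–I.4] -/
theorem isCompact_centralizer_mk_of_irreducible {ϖ : F} (hϖ : Valued.v ϖ = WithZero.exp (-1 : ℤ)) (hϖ0 : ϖ ≠ 0)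
    [((Subgroup.zpowers (Units.mk0 ϖ hϖ0)).map (Matrix.GeneralLinearGroup.scalar (Fin 2))).Normal]
    (g : GL (Fin 2) F) (hirr : Irreducible (g : Matrix (Fin 2) (Fin 2) F).charpoly) :
    IsCompact ((Subgroup.centralizer {(QuotientGroup.mk g : GL (Fin 2) F ⧸ (Subgroup.zpowers (Units.mk0 ϖ hϖ0)).map (Matrix.GeneralLinearGroup.scalar (Fin 2)))} :
      Subgroup (GL (Fin 2) F ⧸ (Subgroup.zpowers (Units.mk0 ϖ hϖ0)).map (Matrix.GeneralLinearGroup.scalar (Fin 2)))) :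
        Set (GL (Fin 2) F ⧸ (Subgroup.zpowers (Units.mk0 ϖ hϖ0)).map (Matrix.GeneralLinearGroup.scalar (Fin 2)))) := by
  set X : Matrix (Fin 2) (Fin 2) F := (g : Matrix (Fin 2) (Fin 2) F) with hXdef
  set P : (Fin 2 → F) → Matrix (Fin 2) (Fin 2) F := fun c => ∑ k : Fin 2, c k • X ^ (k : ℕ) with hPdef
  set S : Set (Fin 2 → F) := {c | (∀ k, Valued.v (c k) ≤ 1) ∧ ∃ k, Valued.v (c k) = 1} with hSdef
  have hS : IsCompact S := isCompact_shell_two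
  have hS0 : ∀ c ∈ S, c ≠ 0 := by
    rintro c ⟨-, k, hk⟩ rfl
    rw [Pi.zero_apply, map_zero] at hk
    exact zero_ne_one hk
  haveI : CompactSpace S := isCompact_iff_compactSpace.1 hS
  have hdet : ∀ c : S, IsUnit (P c).det := fun c => (Matrix.isUnit_iff_isUnit_det _).1 (isUnit_sum_smul_pow_of_irreducible X hirr (hS0 c c.2))
  set φ : S → GL (Fin 2) F := fun c => (P c).nonsingInvUnit (hdet c) with hφdef
  have hφval : ∀ c : S, ((φ c : GL (Fin 2) F) : Matrix (Fin 2) (Fin 2) F) = P c := fun c => rfl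
  -- `φ` is continuous
  have hPc : Continuous fun c : S => P c := by
    show Continuous fun c : S => ∑ k : Fin 2, (c : Fin 2 → F) k • X ^ (k : ℕ)
    exact continuous_finsetSum _ fun k _ => ((continuous_apply k).comp continuous_subtype_val).smul continuous_const
  have hφc : Continuous φ := by
    refine Units.continuous_iff.2 ⟨hPc, ?_⟩
    have h : (fun c : S => (((φ c)⁻¹ : GL (Fin 2) F) : Matrix (Fin 2) (Fin 2) F)) = fun c : S => ((P c).det)⁻¹ • (P c).adjugate := by
      funext c
      rw [Matrix.coe_units_inv, hφval, Matrix.inv_def, Ring.inverse_eq_inv]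
    rw [h]
    exact (hPc.matrix_det.inv₀ fun c => (hdet c).ne_zero).smul hPc.matrix_adjugate
  -- `Z_{G'}(ḡ) = mk(φ(S))`
  have himage : ((Subgroup.centralizer {(QuotientGroup.mk g : GL (Fin 2) F ⧸ (Subgroup.zpowers (Units.mk0 ϖ hϖ0)).map (Matrix.GeneralLinearGroup.scalar (Fin 2)))} :
      Subgroup (GL (Fin 2) F ⧸ (Subgroup.zpowers (Units.mk0 ϖ hϖ0)).map (Matrix.GeneralLinearGroup.scalar (Fin 2)))) :
        Set (GL (Fin 2) F ⧸ (Subgroup.zpowers (Units.mk0 ϖ hϖ0)).map (Matrix.GeneralLinearGroup.scalar (Fin 2)))) =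
      (QuotientGroup.mk : GL (Fin 2) F → GL (Fin 2) F ⧸ (Subgroup.zpowers (Units.mk0 ϖ hϖ0)).map (Matrix.GeneralLinearGroup.scalar (Fin 2))) '' Set.range φ := by
    ext x
    constructor
    · intro hx
      obtain ⟨y, rfl⟩ := QuotientGroup.mk_surjective x
      have hy : y * g = g * y := (mk_mem_centralizer_mk_iff hϖ hϖ0 g y).1 hx
      have hy' : (y : Matrix (Fin 2) (Fin 2) F) * X = X * (y : Matrix (Fin 2) (Fin 2) F) := by
        rw [hXdef, ← Units.val_mul, ← Units.val_mul, hy]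
      obtain ⟨c, hc⟩ := exists_eq_sum_smul_pow_of_irreducible X hirr hy'
      have hc0 : c ≠ 0 := by
        rintro rfl
        have h0 : (y : Matrix (Fin 2) (Fin 2) F) = 0 := by rw [hc]; simp
        exact Matrix.GeneralLinearGroup.det_ne_zero y (by rw [h0, Matrix.det_zero])
      obtain ⟨n, hn, hn1⟩ := exists_zpow_mul_mem_shell hϖ c hc0
      have hc'S : (fun k => ϖ ^ n * c k) ∈ S := ⟨hn, hn1⟩
      refine ⟨φ ⟨fun k => ϖ ^ n * c k, hc'S⟩, ⟨_, rfl⟩, ?_⟩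
      -- `φ(ϖ^n c) = (ϖ^n·1) · y`
      have hval : ((φ ⟨fun k => ϖ ^ n * c k, hc'S⟩ : GL (Fin 2) F) : Matrix (Fin 2) (Fin 2) F) =
          ((Matrix.GeneralLinearGroup.scalar (Fin 2) (Units.mk0 ϖ hϖ0 ^ n) * y : GL (Fin 2) F) : Matrix (Fin 2) (Fin 2) F) := by
        rw [hφval]
        change (∑ k : Fin 2, (ϖ ^ n * c k) • X ^ (k : ℕ)) = _
        rw [sum_mul_smul_pow, Units.val_mul, Matrix.GeneralLinearGroup.coe_scalar, Matrix.scalar_apply, ← Matrix.smul_eq_diagonal_mul,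
          Units.val_zpow_eq_zpow_val, Units.val_mk0, ← hc]
      rw [Units.ext hval, QuotientGroup.mk_mul,
        (QuotientGroup.eq_one_iff _).2 (Subgroup.mem_map_of_mem _ (Subgroup.zpow_mem _ (Subgroup.mem_zpowers _) n)), one_mul]
    · rintro ⟨_, ⟨c, rfl⟩, rfl⟩
      refine (mk_mem_centralizer_mk_iff hϖ hϖ0 g _).2 (Units.ext ?_)
      rw [Units.val_mul, Units.val_mul, hφval]
      exact sum_smul_pow_mul_comm X c
  rw [himage]
  exact (isCompact_range hφc).image QuotientGroup.continuous_mk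

/-- **THE CRITERION: `Z_{G'}(ḡ)` is compact iff `χ_g` is irreducible** (`χ_g` separable; `G' = GL₂(F) ⧸ ϖ^ℤ·1`).
[cite: HarishChandra1970, Part VII §3; cite: Cartier1979, §I.3–I.4] -/
theorem isCompact_centralizer_mk_iff_irreducible [CharZero F] {ϖ : F} (hϖ : Valued.v ϖ = WithZero.exp (-1 : ℤ)) (hϖ0 : ϖ ≠ 0)
    [((Subgroup.zpowers (Units.mk0 ϖ hϖ0)).map (Matrix.GeneralLinearGroup.scalar (Fin 2))).Normal]
    (g : GL (Fin 2) F) (hsep : (g : Matrix (Fin 2) (Fin 2) F).charpoly.Separable) :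
    IsCompact ((Subgroup.centralizer {(QuotientGroup.mk g : GL (Fin 2) F ⧸ (Subgroup.zpowers (Units.mk0 ϖ hϖ0)).map (Matrix.GeneralLinearGroup.scalar (Fin 2)))} :
      Subgroup (GL (Fin 2) F ⧸ (Subgroup.zpowers (Units.mk0 ϖ hϖ0)).map (Matrix.GeneralLinearGroup.scalar (Fin 2)))) :
        Set (GL (Fin 2) F ⧸ (Subgroup.zpowers (Units.mk0 ϖ hϖ0)).map (Matrix.GeneralLinearGroup.scalar (Fin 2)))) ↔
      Irreducible (g : Matrix (Fin 2) (Fin 2) F).charpoly :=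
  ⟨fun h => by_contra fun hirr => not_isCompact_centralizer_mk_of_not_irreducible hϖ hϖ0 g hsep hirr h,
    isCompact_centralizer_mk_of_irreducible hϖ hϖ0 g⟩

/-- **THE CASE SPLIT OF THE NON-ELLIPTIC BRICKS AT `N = 2`** (`χ_g` separable, characteristic zero): `Z_{G'}(ḡ)` is NOT compact iff `g = h · diag d · h⁻¹`
with `d` injective (two distinct rational eigenvalues).  There is no mixed case. [cite: HarishChandra1970, Part VII §3; cite: PlatonovRapinchuk1994, §3.3] -/
theorem not_isCompact_centralizer_mk_iff [CharZero F] {ϖ : F} (hϖ : Valued.v ϖ = WithZero.exp (-1 : ℤ)) (hϖ0 : ϖ ≠ 0)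
    [((Subgroup.zpowers (Units.mk0 ϖ hϖ0)).map (Matrix.GeneralLinearGroup.scalar (Fin 2))).Normal]
    (g : GL (Fin 2) F) (hsep : (g : Matrix (Fin 2) (Fin 2) F).charpoly.Separable) :
    ¬ IsCompact ((Subgroup.centralizer {(QuotientGroup.mk g : GL (Fin 2) F ⧸ (Subgroup.zpowers (Units.mk0 ϖ hϖ0)).map (Matrix.GeneralLinearGroup.scalar (Fin 2)))} :
      Subgroup (GL (Fin 2) F ⧸ (Subgroup.zpowers (Units.mk0 ϖ hϖ0)).map (Matrix.GeneralLinearGroup.scalar (Fin 2)))) :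
        Set (GL (Fin 2) F ⧸ (Subgroup.zpowers (Units.mk0 ϖ hϖ0)).map (Matrix.GeneralLinearGroup.scalar (Fin 2)))) ↔
      ∃ (h : GL (Fin 2) F) (d : Fin 2 → F), Function.Injective d ∧
        (g : Matrix (Fin 2) (Fin 2) F) = (h : Matrix (Fin 2) (Fin 2) F) * Matrix.diagonal d * ((h⁻¹ : GL (Fin 2) F) : Matrix (Fin 2) (Fin 2) F) := by
  rw [isCompact_centralizer_mk_iff_irreducible hϖ hϖ0 g hsep, irreducible_charpoly_two_iff_card_roots_eq_zero]
  constructor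
  · intro h0
    rcases card_roots_charpoly_two_eq_zero_or_two (g : Matrix (Fin 2) (Fin 2) F) with h | h
    · exact absurd h h0
    · exact exists_conj_diagonal_of_card_roots_eq_two _ h
        (discr_ne_zero_of_separable (Matrix.charpoly_monic _) (by rw [Matrix.charpoly_natDegree_eq_dim, Fintype.card_fin]; norm_num) hsep)
  · rintro ⟨h, d, -, hX⟩
    rw [hX, card_roots_charpoly_conj_diagonal]
    norm_num

end Compact

end Summit.HodgeConjecture.HodgeConjecture.Cruxes.H413.K2E3GL2ModUniformizerCentralizerCompact

end
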